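import Mathlib.Data.Matrix.Basic
import Mathlib.Data.Real.Basic
import Mathlib.Algebra.Order.BigOperators.Ring.Finset
import Mathlib.Data.Fin.Tuple.Basic
import Mathlib.Data.List.OfFn
import HarnessLib
import Summits.CriticalPhenomena.PercolationContinuityZ3.Theorems.PercNearOneGluingNoHeavyLowerTailThreePointProductFormTransducer

/-!
# Transducer contraction certificates with FREE BOUNDARY STEPS (every length): `X = A · T^k · Y`
# (Sahi programme, prover prim-sahi-p2 gen 62)

Support file (`--supports stmt-CriticalPhenomena-4575`, helper).  Standard axioms, no sorries, no definitions.  Memo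
`run/shared/lean/prim/prim-sahi/FROM-prim-sahi-p2-gen62-TRANSDUCER.md` §1, §3.

Companion of `…ThreePointProductFormTransducer`: there the boundary vectors `α, ω` of the matrix-product operator are fixed; the
semidefinite programme of gen 62 (§3 of the memo) instead leaves the FIRST and the LAST site free — families `A e e' : B → ℝ`
(first site, absorbing `α`) and `Y e e' : B → ℝ` (last site, absorbing `ω`) — and keeps one stationary bulk tensor `T` with a
quadratic gauge `Q`.  For first letters `(e₀,e₀')`, a bulk word pair `(p,p')` of length `k` and last letters `(e₁,e₁')` the operator is
`X[(e₀,p,e₁),(e₀',p',e₁')] = A e₀ e₀' ⬝ᵥ ((Π_i T (p i) (p' i)) *ᵥ Y e₁ e₁')`.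
Hypotheses (all quadratic-form inequalities, i.e. LMIs): base `𝒜ᵀ𝒜 ⪯ Q ⊗ I` (`hbase`), step `∑_{e'} T[·,e']ᵀ Q T[·,e'] ⪯ Q ⊗ I`
(`hstep`), end `∑_{e'} Y(·,e')ᵀ Q Y(·,e') ⪯ λ I` (`hend`).  Conclusion: `(∑ ξ X η)² ≤ λ ∑ξ² ∑η²` for EVERY bulk length `k`.
* **`transducer_gram_le_of_base`** [this work] — inductive Gram bound with a free first-site family.
* **`transducer_free_bilin_sq_le`** [this work] — the bilinear bound.
[folklore] (isometric tensor-network / quadratic Lyapunov argument; this finite-sum form is ours).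
-/

namespace Summit.CriticalPhenomena.PercolationContinuityZ3.Theorems.ProductFormTransducerFree

open Matrix

variable {B E₁ E₂ : Type*} [Fintype B] [DecidableEq B] [Fintype E₁] [Fintype E₂]

open Summit.CriticalPhenomena.PercolationContinuityZ3.Theorems.ProductFormTransducer (sum_pi_fin_succ prod_ofFn_snoc)

/-- **Inductive Gram bound with a free first-site family** [this work].  If `∑_{e'} (∑_e A e e' ⬝ᵥ c_e)² ≤ ∑_e c_eᵀ Q c_e` for all
families `c` (base: `𝒜ᵀ𝒜 ⪯ Q ⊗ I`) and the one-step condition holds for `T`, then for every bulk length `k` and every family `c`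
indexed by (first letter, bulk word): `∑_{e₀',p'} (∑_{e₀,p} A e₀ e₀' ⬝ᵥ (Π_i T(p i)(p' i)) c_{e₀,p})² ≤ ∑_{e₀,p} c_{e₀,p}ᵀ Q c_{e₀,p}`. -/
theorem transducer_gram_le_of_base (A : E₁ → E₂ → B → ℝ) (T : E₁ → E₂ → Matrix B B ℝ) (Q : Matrix B B ℝ)
    (hbase : ∀ c : E₁ → B → ℝ, ∑ e', (∑ e, A e e' ⬝ᵥ c e) ^ 2 ≤ ∑ e, c e ⬝ᵥ (Q *ᵥ c e))
    (hstep : ∀ v : E₁ → B → ℝ,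
      ∑ e', (∑ e, T e e' *ᵥ v e) ⬝ᵥ (Q *ᵥ ∑ e, T e e' *ᵥ v e) ≤ ∑ e, v e ⬝ᵥ (Q *ᵥ v e)) :
    ∀ (k : ℕ) (c : E₁ → (Fin k → E₁) → B → ℝ),
      ∑ e₀' : E₂, ∑ p' : Fin k → E₂,
          (∑ e₀ : E₁, ∑ p : Fin k → E₁, A e₀ e₀' ⬝ᵥ ((List.ofFn fun i => T (p i) (p' i)).prod *ᵥ c e₀ p)) ^ 2
        ≤ ∑ e₀ : E₁, ∑ p : Fin k → E₁, c e₀ p ⬝ᵥ (Q *ᵥ c e₀ p) := by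
  intro k
  induction k with
  | zero =>
    intro c
    simp only [Fintype.sum_unique, List.ofFn_zero, List.prod_nil, Matrix.one_mulVec]
    exact hbase _
  | succ k ih =>
    intro c
    rw [show (∑ e₀ : E₁, ∑ p : Fin (k + 1) → E₁, c e₀ p ⬝ᵥ (Q *ᵥ c e₀ p))
        = ∑ e₀ : E₁, ∑ e : E₁, ∑ t : Fin k → E₁, c e₀ (Fin.snoc t e) ⬝ᵥ (Q *ᵥ c e₀ (Fin.snoc t e)) from
        Finset.sum_congr rfl fun e₀ _ => sum_pi_fin_succ _]
    rw [show (∑ e₀' : E₂, ∑ p' : Fin (k + 1) → E₂,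
          (∑ e₀ : E₁, ∑ p : Fin (k + 1) → E₁, A e₀ e₀' ⬝ᵥ ((List.ofFn fun i => T (p i) (p' i)).prod *ᵥ c e₀ p)) ^ 2)
        = ∑ e₀' : E₂, ∑ e' : E₂, ∑ t' : Fin k → E₂,
          (∑ e₀ : E₁, ∑ p : Fin (k + 1) → E₁,
            A e₀ e₀' ⬝ᵥ ((List.ofFn fun i => T (p i) ((Fin.snoc t' e' : Fin (k + 1) → E₂) i)).prod *ᵥ c e₀ p)) ^ 2 from
        Finset.sum_congr rfl fun e₀' _ => sum_pi_fin_succ _]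
    set ct : E₂ → E₁ → (Fin k → E₁) → B → ℝ := fun e' e₀ t => ∑ e, T e e' *ᵥ c e₀ (Fin.snoc t e) with hct
    have hinner : ∀ (e₀' e' : E₂) (t' : Fin k → E₂),
        (∑ e₀ : E₁, ∑ p : Fin (k + 1) → E₁,
            A e₀ e₀' ⬝ᵥ ((List.ofFn fun i => T (p i) ((Fin.snoc t' e' : Fin (k + 1) → E₂) i)).prod *ᵥ c e₀ p))
          = ∑ e₀ : E₁, ∑ t : Fin k → E₁, A e₀ e₀' ⬝ᵥ ((List.ofFn fun i => T (t i) (t' i)).prod *ᵥ ct e' e₀ t) := by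
      intro e₀' e' t'
      refine Finset.sum_congr rfl fun e₀ _ => ?_
      rw [sum_pi_fin_succ (fun p : Fin (k + 1) → E₁ =>
        A e₀ e₀' ⬝ᵥ ((List.ofFn fun i => T (p i) ((Fin.snoc t' e' : Fin (k + 1) → E₂) i)).prod *ᵥ c e₀ p))]
      rw [Finset.sum_comm]
      refine Finset.sum_congr rfl fun t _ => ?_
      simp only [hct, prod_ofFn_snoc, ← Matrix.mulVec_mulVec]
      rw [Matrix.mulVec_sum, dotProduct_sum]
    calc ∑ e₀' : E₂, ∑ e' : E₂, ∑ t' : Fin k → E₂,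
          (∑ e₀ : E₁, ∑ p : Fin (k + 1) → E₁,
            A e₀ e₀' ⬝ᵥ ((List.ofFn fun i => T (p i) ((Fin.snoc t' e' : Fin (k + 1) → E₂) i)).prod *ᵥ c e₀ p)) ^ 2
        = ∑ e' : E₂, ∑ e₀' : E₂, ∑ t' : Fin k → E₂,
            (∑ e₀ : E₁, ∑ t : Fin k → E₁, A e₀ e₀' ⬝ᵥ ((List.ofFn fun i => T (t i) (t' i)).prod *ᵥ ct e' e₀ t)) ^ 2 := by
          rw [Finset.sum_comm]; simp only [hinner]
      _ ≤ ∑ e' : E₂, ∑ e₀ : E₁, ∑ t : Fin k → E₁, ct e' e₀ t ⬝ᵥ (Q *ᵥ ct e' e₀ t) :=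
          Finset.sum_le_sum fun e' _ => ih (ct e')
      _ = ∑ e₀ : E₁, ∑ t : Fin k → E₁, ∑ e' : E₂, ct e' e₀ t ⬝ᵥ (Q *ᵥ ct e' e₀ t) := by
          rw [Finset.sum_comm]; exact Finset.sum_congr rfl fun e₀ _ => Finset.sum_comm
      _ ≤ ∑ e₀ : E₁, ∑ t : Fin k → E₁, ∑ e : E₁, c e₀ (Fin.snoc t e) ⬝ᵥ (Q *ᵥ c e₀ (Fin.snoc t e)) :=
          Finset.sum_le_sum fun e₀ _ => Finset.sum_le_sum fun t _ => hstep (fun e => c e₀ (Fin.snoc t e))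
      _ = ∑ e₀ : E₁, ∑ e : E₁, ∑ t : Fin k → E₁, c e₀ (Fin.snoc t e) ⬝ᵥ (Q *ᵥ c e₀ (Fin.snoc t e)) :=
          Finset.sum_congr rfl fun e₀ _ => Finset.sum_comm

/-- **Uniform bilinear bound with free boundary steps** [this work].  With the base, step and end conditions
(`hbase`: `𝒜ᵀ𝒜 ⪯ Q⊗I`; `hstep`: `∑_{e'} T[·,e']ᵀQT[·,e'] ⪯ Q⊗I`; `hend`: `∑_{e'} Y(·,e')ᵀ Q Y(·,e') ⪯ λ I`), for EVERY bulk length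
`k` and all real `ξ, η` indexed by (first letter, bulk word, last letter) (the `η`-indices summed outermost):
`(∑_{e₀',p',e₁'} ∑_{e₀,p,e₁} ξ_{e₀,p,e₁} · A e₀ e₀' ⬝ᵥ (Π_i T(p i)(p' i)) Y e₁ e₁' · η_{e₀',p',e₁'})² ≤ λ · ∑ξ² · ∑η²`.
This is the shape of the gen-62 all-`k` certificate for the boundary-star cycle inequality `bad² ≤ #P1·#P2`. -/
theorem transducer_free_bilin_sq_le (A : E₁ → E₂ → B → ℝ) (T : E₁ → E₂ → Matrix B B ℝ) (Y : E₁ → E₂ → B → ℝ)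
    (Q : Matrix B B ℝ) (lam : ℝ)
    (hbase : ∀ c : E₁ → B → ℝ, ∑ e', (∑ e, A e e' ⬝ᵥ c e) ^ 2 ≤ ∑ e, c e ⬝ᵥ (Q *ᵥ c e))
    (hstep : ∀ v : E₁ → B → ℝ,
      ∑ e', (∑ e, T e e' *ᵥ v e) ⬝ᵥ (Q *ᵥ ∑ e, T e e' *ᵥ v e) ≤ ∑ e, v e ⬝ᵥ (Q *ᵥ v e))
    (hend : ∀ z : E₁ → ℝ, ∑ e', (∑ e, z e • Y e e') ⬝ᵥ (Q *ᵥ ∑ e, z e • Y e e') ≤ lam * ∑ e, z e ^ 2)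
    (k : ℕ) (ξ : E₁ → (Fin k → E₁) → E₁ → ℝ) (η : E₂ → (Fin k → E₂) → E₂ → ℝ) :
    (∑ e₀', ∑ p' : Fin k → E₂, ∑ e₁', ∑ e₀, ∑ p : Fin k → E₁, ∑ e₁,
        ξ e₀ p e₁ * (A e₀ e₀' ⬝ᵥ ((List.ofFn fun i => T (p i) (p' i)).prod *ᵥ Y e₁ e₁')) * η e₀' p' e₁') ^ 2
      ≤ lam * (∑ e₀, ∑ p : Fin k → E₁, ∑ e₁, ξ e₀ p e₁ ^ 2) * (∑ e₀', ∑ p' : Fin k → E₂, ∑ e₁', η e₀' p' e₁' ^ 2) := by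
  -- the reduced families c_{e₁'}(e₀,p) = ∑_{e₁} ξ • Y e₁ e₁'
  set c : E₂ → E₁ → (Fin k → E₁) → B → ℝ := fun e₁' e₀ p => ∑ e₁, ξ e₀ p e₁ • Y e₁ e₁' with hc
  set W : E₂ → E₂ → (Fin k → E₂) → ℝ := fun e₁' e₀' p' =>
    ∑ e₀, ∑ p : Fin k → E₁, A e₀ e₀' ⬝ᵥ ((List.ofFn fun i => T (p i) (p' i)).prod *ᵥ c e₁' e₀ p) with hW
  -- rewrite the bilinear value as ∑_{e₀',p',e₁'} W · η
  have hval : (∑ e₀', ∑ p' : Fin k → E₂, ∑ e₁', ∑ e₀, ∑ p : Fin k → E₁, ∑ e₁,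
        ξ e₀ p e₁ * (A e₀ e₀' ⬝ᵥ ((List.ofFn fun i => T (p i) (p' i)).prod *ᵥ Y e₁ e₁')) * η e₀' p' e₁')
      = ∑ e₀', ∑ p' : Fin k → E₂, ∑ e₁', W e₁' e₀' p' * η e₀' p' e₁' := by
    refine Finset.sum_congr rfl fun e₀' _ => Finset.sum_congr rfl fun p' _ => Finset.sum_congr rfl fun e₁' _ => ?_
    rw [hW, hc]
    simp only [Finset.sum_mul]
    refine Finset.sum_congr rfl fun e₀ _ => Finset.sum_congr rfl fun p _ => ?_
    rw [Matrix.mulVec_sum, dotProduct_sum, Finset.sum_mul]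
    refine Finset.sum_congr rfl fun e₁ _ => ?_
    rw [Matrix.mulVec_smul, dotProduct_smul, smul_eq_mul]
  have hgram : ∀ e₁', ∑ e₀', ∑ p' : Fin k → E₂, W e₁' e₀' p' ^ 2
      ≤ ∑ e₀, ∑ p : Fin k → E₁, c e₁' e₀ p ⬝ᵥ (Q *ᵥ c e₁' e₀ p) :=
    fun e₁' => transducer_gram_le_of_base A T Q hbase hstep k (c e₁')
  have hend' : ∀ (e₀ : E₁) (p : Fin k → E₁),
      ∑ e₁', c e₁' e₀ p ⬝ᵥ (Q *ᵥ c e₁' e₀ p) ≤ lam * ∑ e₁, ξ e₀ p e₁ ^ 2 :=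
    fun e₀ p => hend (ξ e₀ p)
  -- Cauchy–Schwarz over the index (e₀',p',e₁')
  have hcs : (∑ e₀', ∑ p' : Fin k → E₂, ∑ e₁', W e₁' e₀' p' * η e₀' p' e₁') ^ 2
      ≤ (∑ e₀', ∑ p' : Fin k → E₂, ∑ e₁', W e₁' e₀' p' ^ 2) * (∑ e₀', ∑ p' : Fin k → E₂, ∑ e₁', η e₀' p' e₁' ^ 2) := by
    have := Finset.sum_mul_sq_le_sq_mul_sq Finset.univ
      (fun x : E₂ × (Fin k → E₂) × E₂ => W x.2.2 x.1 x.2.1) (fun x => η x.1 x.2.1 x.2.2)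
    simpa only [Fintype.sum_prod_type] using this
  have hswap : (∑ e₀', ∑ p' : Fin k → E₂, ∑ e₁', W e₁' e₀' p' ^ 2) = ∑ e₁', ∑ e₀', ∑ p' : Fin k → E₂, W e₁' e₀' p' ^ 2 := by
    have h1 : (∑ e₀', ∑ p' : Fin k → E₂, ∑ e₁', W e₁' e₀' p' ^ 2) = ∑ e₀', ∑ e₁', ∑ p' : Fin k → E₂, W e₁' e₀' p' ^ 2 :=
      Finset.sum_congr rfl fun e₀' _ => Finset.sum_comm
    rw [h1, Finset.sum_comm]
  have hWbound : (∑ e₀', ∑ p' : Fin k → E₂, ∑ e₁', W e₁' e₀' p' ^ 2) ≤ lam * ∑ e₀, ∑ p : Fin k → E₁, ∑ e₁, ξ e₀ p e₁ ^ 2 := by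
    calc (∑ e₀', ∑ p' : Fin k → E₂, ∑ e₁', W e₁' e₀' p' ^ 2)
        = ∑ e₁', ∑ e₀', ∑ p' : Fin k → E₂, W e₁' e₀' p' ^ 2 := hswap
      _ ≤ ∑ e₁', ∑ e₀, ∑ p : Fin k → E₁, c e₁' e₀ p ⬝ᵥ (Q *ᵥ c e₁' e₀ p) := Finset.sum_le_sum fun e₁' _ => hgram e₁'
      _ = ∑ e₀, ∑ p : Fin k → E₁, ∑ e₁', c e₁' e₀ p ⬝ᵥ (Q *ᵥ c e₁' e₀ p) := by
          rw [Finset.sum_comm]; exact Finset.sum_congr rfl fun e₀ _ => Finset.sum_comm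
      _ ≤ ∑ e₀, ∑ p : Fin k → E₁, lam * ∑ e₁, ξ e₀ p e₁ ^ 2 :=
          Finset.sum_le_sum fun e₀ _ => Finset.sum_le_sum fun p _ => hend' e₀ p
      _ = lam * ∑ e₀, ∑ p : Fin k → E₁, ∑ e₁, ξ e₀ p e₁ ^ 2 := by
          rw [Finset.mul_sum]; refine Finset.sum_congr rfl fun e₀ _ => ?_; rw [Finset.mul_sum]
  have hη : 0 ≤ ∑ e₀', ∑ p' : Fin k → E₂, ∑ e₁', η e₀' p' e₁' ^ 2 :=
    Finset.sum_nonneg fun _ _ => Finset.sum_nonneg fun _ _ => Finset.sum_nonneg fun _ _ => sq_nonneg _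
  rw [hval]
  calc (∑ e₀', ∑ p' : Fin k → E₂, ∑ e₁', W e₁' e₀' p' * η e₀' p' e₁') ^ 2
      ≤ (∑ e₀', ∑ p' : Fin k → E₂, ∑ e₁', W e₁' e₀' p' ^ 2) * (∑ e₀', ∑ p' : Fin k → E₂, ∑ e₁', η e₀' p' e₁' ^ 2) := hcs
    _ ≤ (lam * ∑ e₀, ∑ p : Fin k → E₁, ∑ e₁, ξ e₀ p e₁ ^ 2) * (∑ e₀', ∑ p' : Fin k → E₂, ∑ e₁', η e₀' p' e₁' ^ 2) :=
        mul_le_mul_of_nonneg_right hWbound hη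
    _ = lam * (∑ e₀, ∑ p : Fin k → E₁, ∑ e₁, ξ e₀ p e₁ ^ 2) * (∑ e₀', ∑ p' : Fin k → E₂, ∑ e₁', η e₀' p' e₁' ^ 2) := by ring

end Summit.CriticalPhenomena.PercolationContinuityZ3.Theorems.ProductFormTransducerFree
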